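import Literature.NumberTheory.Automorphic.ArchCellStabilizerExpansion
import Literature.Analysis.Distribution.NormalDescentTransport
import HarnessLib

/-!
# First-order vanishing of a quasi-invariant distribution across an irrelevant point of a small cell

[cite: Shalika1974, §2, Thm. 2.1]; [cite: HormanderALPDO1, Thm. 2.3.5].

This is Step 2 of Shalika's small-cell analysis for `GL_n(K_∞)` (J. A. Shalika, *The multiplicity one theorem
for `GL_n`*, Ann. of Math. 100 (1974), §2), at a point `e₀ = (0, a, 0)` of the parameter space of a translated
big-cell chart `ẇΨ`, `ẇ = ẇ(τ)`, `τ_v = rev ∘ σ`, lying on the cell `B P_σ U` at the place `v` (`X₁ = 0`).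

Let `T` be a distribution on `GL_n(K_∞)` which is left and right quasi-invariant under `U_n(K_∞)` for the
generic character, and `E = cellPull (T ∘ λ(ẇ))` its pull-back to the chart.  For a bad pair `(i₀, j₀)` of `σ`
and `θ = 1_v θ` the stabilizer field `W = d(Ψ⁻¹)(-stabY·Ψ + Ψ·stabX)` of `ArchCellStabilizerField` is expanded
(`ArchCellStabilizerExpansion`) as `Σ_i c_i V_i` over the constant root fields
`V = L_{E_{kl} ε}` (`f k < f l`, `f = σ⁻¹ ∘ rev`) and `V = R_{E_{kl} ε}` (`k < l`), `ε ∈ {1_v, i_v}`, each of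
which satisfies a first-order equation `E (V g) = μ E g` (left/right quasi-invariance transported to the chart,
`ArchDistributionLeftTranslate`, `ArchBigCellDerivatives`).  The field `W` vanishes on the cell, its bad
linearization at `e₀` is nilpotent, the multiplier `Σ_i V_i(c_i)(e₀)` vanishes, and the eigenvalue
`Σ_i c_i(e₀) μ_i` is `dψ(θ E_{f j₀, f i₀}) - dψ(a_{rev j₀}⁻¹ θ a_{rev i₀} E_{rev j₀, rev i₀})`.  Hence, by the
abstract first-order descent `Literature.Analysis.Distribution.vanish_near_of_firstOrder` (Hörmander,
Thm. 2.3.5), **if this eigenvalue is non-zero (`e₀` irrelevant for `(i₀, j₀, θ)`) and `E` already vanishes near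
`e₀` off the cell, then `E` vanishes near `e₀`** (`cellPull_leftTranslate_vanish_near`).

Everything is proved; no new facts.
-/

noncomputable section

open NumberField NumberField.InfinitePlace NumberField.mixedEmbedding Set Filter Matrix Complex
open Literature.Analysis.Distribution
open scoped MatrixGroups Topology Classical ContDiff Matrix.Norms.Operator ComplexConjugate

namespace Literature.NumberTheory.Automorphic

set_option backward.isDefEq.respectTransparency false

variable {n : ℕ} {K : Type} [Field K] [NumberField K]

local notation "R∞" => mixedSpace K
local notation "Mat" => Matrix (Fin n) (Fin n) (mixedSpace K)
local notation "G∞" => GL (Fin n) (mixedSpace K)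
local notation "E∞" => CellParam n (mixedSpace K)
local notation "w₀" => ((weylLong n (mixedSpace K) : GL (Fin n) (mixedSpace K)) : Matrix (Fin n) (Fin n) (mixedSpace K))

/-- `M_n(K_∞)` is finite-dimensional over `ℝ` (local instance, as in `ArchBigCellDerivatives`). [folklore] -/
private theorem finiteDimensional_matrix_mixedSpace_fo : FiniteDimensional ℝ (Matrix (Fin n) (Fin n) (mixedSpace K)) :=
  Module.Finite.matrix

attribute [local instance] finiteDimensional_matrix_mixedSpace_fo

/-- The parameter space is finite-dimensional over `ℝ` (local instance). [folklore] -/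
private theorem finiteDimensional_cellParam_fo : FiniteDimensional ℝ (CellParam n (mixedSpace K)) := by
  unfold CellParam; infer_instance

attribute [local instance] finiteDimensional_cellParam_fo

/-! ### 1. Generalities: cutoffs, entries, Fréchet derivatives of `stabY`, `stabX` -/

section General

/-- A product `χ • f` with `f` smooth on an open set containing `tsupport χ` is smooth. [folklore] -/
theorem contDiff_smul_of_tsupport_subset {F : Type*} [NormedAddCommGroup F] [NormedSpace ℝ F] {χ : E∞ → ℝ} {f : E∞ → F}
    {U : Set E∞} (hχ : ContDiff ℝ ∞ χ) (hU : IsOpen U) (hf : ContDiffOn ℝ ∞ f U) (hsupp : tsupport χ ⊆ U) :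
    ContDiff ℝ ∞ fun x => χ x • f x := by
  refine contDiff_iff_contDiffAt.2 fun x => ?_
  by_cases hx : x ∈ U
  · exact hχ.contDiffAt.smul (hf.contDiffAt (hU.mem_nhds hx))
  · have hx' : x ∉ tsupport χ := fun h => hx (hsupp h)
    have hev : (fun y => χ y • f y) =ᶠ[𝓝 x] fun _ => 0 := by
      filter_upwards [notMem_tsupport_iff_eventuallyEq.1 hx'] with y hy
      rw [hy, Pi.zero_apply, zero_smul]
    exact contDiffAt_const.congr_of_eventuallyEq hev

/-- **A smooth cutoff** equal to `1` on a ball around `e₀` and supported in a given open neighbourhood. [folklore] -/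
theorem exists_smooth_cutoff {U : Set E∞} (hU : IsOpen U) {e₀ : E∞} (he₀ : e₀ ∈ U) :
    ∃ (χ : E∞ → ℝ) (r : ℝ), 0 < r ∧ ContDiff ℝ ∞ χ ∧ tsupport χ ⊆ U ∧ (∀ x ∈ Metric.ball e₀ r, χ x = 1) ∧ Metric.ball e₀ r ⊆ U := by
  obtain ⟨R, hR, hRU⟩ : ∃ R > 0, Metric.closedBall e₀ R ⊆ U := Metric.nhds_basis_closedBall.mem_iff.1 (hU.mem_nhds he₀)
  let χ : ContDiffBump e₀ := ⟨R / 2, R, half_pos hR, half_lt_self hR⟩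
  refine ⟨χ, R / 2, half_pos hR, χ.contDiff, ?_, fun x hx => χ.one_of_mem_closedBall (Metric.ball_subset_closedBall hx), ?_⟩
  · rw [χ.tsupport_eq]; exact hRU
  · exact Metric.ball_subset_closedBall.trans ((Metric.closedBall_subset_closedBall (half_le_self hR.le)).trans hRU)

omit [NumberField K] in
/-- The `(k, l)` entry as a continuous linear form on `M_n(K_∞)`. [folklore] -/
def entryCLM (k l : Fin n) : Mat →L[ℝ] R∞ :=
  (ContinuousLinearMap.proj (R := ℝ) l).comp (ContinuousLinearMap.proj (R := ℝ) (φ := fun _ : Fin n => Fin n → R∞) k)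

omit [NumberField K] in
/-- Unfolding `entryCLM`. [folklore] -/
@[simp] theorem entryCLM_apply (k l : Fin n) (M : Mat) : entryCLM k l M = M k l := rfl

variable (v : PlaceIdx K) (σ : Equiv.Perm (Fin n)) (i₀ j₀ : Fin n) (θ : mixedSpace K)

/-- **The Fréchet derivative of `stabY` at a point with `X₁ = 0`**: `D(stabY)(e₀) δ = [π'δ₁, Y₀]`. [folklore] -/
theorem fderiv_stabY_apply {e₀ : E∞} (h₁ : e₀.1 = 0) (δ : E∞) :
    fderiv ℝ (stabY v σ i₀ j₀ θ) e₀ δ = piGood v σ (δ.1 : Mat) * rootLow i₀ j₀ θ - rootLow i₀ j₀ θ * piGood v σ (δ.1 : Mat) := by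
  have hd : DifferentiableAt ℝ (stabY v σ i₀ j₀ θ) e₀ := (contDiff_stabY v σ i₀ j₀ θ).contDiffAt.differentiableAt (by simp)
  have hγ : HasDerivAt (fun t : ℝ => e₀ + t • δ) δ 0 := by
    simpa using ((hasDerivAt_id (0 : ℝ)).smul_const δ).const_add e₀
  exact (hd.hasFDerivAt.comp_hasDerivAt_of_eq (0 : ℝ) hγ (by simp)).unique (hasDerivAt_stabY_line v σ i₀ j₀ θ h₁ δ)

/-- **The Fréchet derivative of `stabX` at `e₀ ∈ cellSource` with `X₂ = 0` on a vector with `δ_a = 0`**: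
`D(stabX)(e₀) δ = [stabX e₀, δ₂]`. [folklore] -/
theorem fderiv_stabX_apply {e₀ δ : E∞} (he₀ : e₀ ∈ cellSource n R∞) (h₂ : e₀.2.2 = 0) (hδ : δ.2.1 = 0) :
    fderiv ℝ (stabX i₀ j₀ θ) e₀ δ = stabX i₀ j₀ θ e₀ * (δ.2.2 : Mat) - (δ.2.2 : Mat) * stabX i₀ j₀ θ e₀ := by
  have hd : DifferentiableAt ℝ (stabX i₀ j₀ θ) e₀ :=
    ((contDiffOn_stabX i₀ j₀ θ).contDiffAt (isOpen_cellSource.mem_nhds he₀)).differentiableAt (by simp)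
  have hγ : HasDerivAt (fun t : ℝ => e₀ + t • δ) δ 0 := by
    simpa using ((hasDerivAt_id (0 : ℝ)).smul_const δ).const_add e₀
  exact (hd.hasFDerivAt.comp_hasDerivAt_of_eq (0 : ℝ) hγ (by simp)).unique (hasDerivAt_stabX_line i₀ j₀ θ he₀ h₂ hδ)

/-- The derivative of `e ↦ placeCoord v s (F e k l)` along `δ` is `placeCoord v s ((DF(e₀) δ) k l)`. [folklore] -/
theorem fderiv_placeCoord_entry {F : E∞ → Mat} {e₀ : E∞} (hF : DifferentiableAt ℝ F e₀) (s : Fin 2) (k l : Fin n) (δ : E∞) :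
    fderiv ℝ (fun e => placeCoord v s (F e k l)) e₀ δ = placeCoord v s (fderiv ℝ F e₀ δ k l) := by
  have h : HasFDerivAt (fun e => placeCoord v s (F e k l)) (((placeCoordCLM v s).comp (entryCLM k l)).comp (fderiv ℝ F e₀)) e₀ :=
    ((placeCoordCLM v s).comp (entryCLM k l)).hasFDerivAt.comp e₀ hF.hasFDerivAt
  rw [h.fderiv]
  rfl

omit [NumberField K] in
/-- `π'` does not enlarge supports. [folklore] -/
theorem piGood_apply_eq_zero {X : Mat} {p q : Fin n} (h : X p q = 0) : piGood v σ X p q = 0 := by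
  rw [piGood, Matrix.sub_apply, piBad_apply, h]
  split_ifs <;> simp

end General

/-! ### 2. The index family, fields, coefficients and eigenvalues -/

section Family

variable (v : PlaceIdx K) (σ : Equiv.Perm (Fin n)) (i₀ j₀ : Fin n) (θ : mixedSpace K)

omit [NumberField K] in
/-- The index type: left root units on the pattern and right root units, each with a real coordinate. [folklore] -/
abbrev FOIdx (σ : Equiv.Perm (Fin n)) : Type := (LeftPatIdx σ × Fin 2) ⊕ (UpperIdx n × Fin 2)

omit [NumberField K] in
/-- The root unit of an index. [folklore] -/
def foUnit (v : PlaceIdx K) (σ : Equiv.Perm (Fin n)) : FOIdx σ → Mat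
  | Sum.inl p => Matrix.single p.1.1.1 p.1.1.2 (placeUnit v p.2)
  | Sum.inr p => Matrix.single p.1.1.1 p.1.1.2 (placeUnit v p.2)

/-- **The fields** `χ L_{E_{kl} ε}` and `χ R_{E_{kl} ε}` in the chart. [folklore] -/
def foField (v : PlaceIdx K) (σ : Equiv.Perm (Fin n)) (χ : E∞ → ℝ) : FOIdx σ → E∞ → E∞
  | Sum.inl p => fun e => χ e • cellVecL (Matrix.single p.1.1.1 p.1.1.2 (placeUnit v p.2)) e
  | Sum.inr p => fun e => χ e • cellVecR (Matrix.single p.1.1.1 p.1.1.2 (placeUnit v p.2)) e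

/-- **The coefficients** `χ · placeCoord(stabY_{kl})` and `χ · placeCoord(stabX_{kl})`. [folklore] -/
def foCoef (v : PlaceIdx K) (σ : Equiv.Perm (Fin n)) (i₀ j₀ : Fin n) (θ : R∞) (χ : E∞ → ℝ) : FOIdx σ → E∞ → ℝ
  | Sum.inl p => fun e => χ e * placeCoord v p.2 (stabY v σ i₀ j₀ θ e p.1.1.1 p.1.1.2)
  | Sum.inr p => fun e => χ e * placeCoord v p.2 (stabX i₀ j₀ θ e p.1.1.1 p.1.1.2)

/-- **The eigenvalues** `dψ(E_{f k, f l} ε)` and `-dψ(E_{kl} ε)`. [folklore] -/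
def foEig (v : PlaceIdx K) (σ : Equiv.Perm (Fin n)) : FOIdx σ → ℂ
  | Sum.inl p => archWhittakerDChar K (patFn σ p.1.1.1) (patFn σ p.1.1.2) (placeUnit v p.2)
  | Sum.inr p => -archWhittakerDChar K p.1.1.1 p.1.1.2 (placeUnit v p.2)

variable (χ : CellParam n (mixedSpace K) → ℝ)

/-- **The total field is `χ² W`** on `cellSource` (expansions `stabY_eq_sum`, `stabX_eq_sum`). [folklore] -/
theorem sum_foCoef_smul_foField (hbad : badPair σ i₀ j₀) (hθ : (placeIdem v : R∞) * θ = θ) {e : E∞} (he : e ∈ cellSource n R∞) :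
    ∑ i, foCoef v σ i₀ j₀ θ χ i e • foField v σ χ i e = (χ e * χ e) • fieldW v σ i₀ j₀ θ e := by
  rw [Fintype.sum_sum_type]
  have hL : ∀ p : LeftPatIdx σ × Fin 2, foCoef v σ i₀ j₀ θ χ (Sum.inl p) e • foField v σ χ (Sum.inl p) e =
      (χ e * χ e) • (placeCoord v p.2 (stabY v σ i₀ j₀ θ e p.1.1.1 p.1.1.2) • cellVecL (Matrix.single p.1.1.1 p.1.1.2 (placeUnit v p.2)) e) :=
    fun p => by simp only [foCoef, foField, smul_smul]; congr 1; ring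
  have hR : ∀ p : UpperIdx n × Fin 2, foCoef v σ i₀ j₀ θ χ (Sum.inr p) e • foField v σ χ (Sum.inr p) e =
      (χ e * χ e) • (placeCoord v p.2 (stabX i₀ j₀ θ e p.1.1.1 p.1.1.2) • cellVecR (Matrix.single p.1.1.1 p.1.1.2 (placeUnit v p.2)) e) :=
    fun p => by simp only [foCoef, foField, smul_smul]; congr 1; ring
  simp only [hL, hR, ← Finset.smul_sum, ← smul_add]
  rw [sum_smul_cellVecL_add_sum_smul_cellVecR, fieldW, stabT]
  have hY : ∑ p : LeftPatIdx σ × Fin 2, placeCoord v p.2 (stabY v σ i₀ j₀ θ e p.1.1.1 p.1.1.2) • (Matrix.single p.1.1.1 p.1.1.2 (placeUnit v p.2) : Mat) =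
      stabY v σ i₀ j₀ θ e := by
    rw [Fintype.sum_prod_type]; exact (stabY_eq_sum v σ i₀ j₀ θ hbad hθ e).symm
  have hX : ∑ p : UpperIdx n × Fin 2, placeCoord v p.2 (stabX i₀ j₀ θ e p.1.1.1 p.1.1.2) • (Matrix.single p.1.1.1 p.1.1.2 (placeUnit v p.2) : Mat) =
      stabX i₀ j₀ θ e := by
    rw [Fintype.sum_prod_type]; exact (stabX_eq_sum v i₀ j₀ θ hbad.1 hθ he).symm
  rw [hY, hX]

/-- **The total field vanishes on the cell.** [folklore] -/
theorem sum_foCoef_smul_foField_eq_zero (hbad : badPair σ i₀ j₀) (hθ : (placeIdem v : R∞) * θ = θ) {e : E∞} (he : e ∈ cellSource n R∞)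
    (hb : piBad v σ (e.1 : Mat) = 0) : ∑ i, foCoef v σ i₀ j₀ θ χ i e • foField v σ χ i e = 0 := by
  rw [sum_foCoef_smul_foField v σ i₀ j₀ θ χ hbad hθ he, fieldW_eq_zero_of_piBad_eq_zero v σ i₀ j₀ θ he hb]
  exact smul_zero _

/-- The fields are smooth when `χ` is smooth with `tsupport χ ⊆ cellSource`. [folklore] -/
theorem contDiff_foField (hχ : ContDiff ℝ ∞ χ) (hsupp : tsupport χ ⊆ cellSource n R∞) (i : FOIdx σ) : ContDiff ℝ ∞ (foField v σ χ i) := by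
  rcases i with p | p
  · exact contDiff_smul_of_tsupport_subset hχ isOpen_cellSource (contDiffOn_cellVecL _) hsupp
  · exact contDiff_smul_of_tsupport_subset hχ isOpen_cellSource (contDiffOn_cellVecR _) hsupp

/-- The coefficients are smooth under the same hypothesis. [folklore] -/
theorem contDiff_foCoef (hχ : ContDiff ℝ ∞ χ) (hsupp : tsupport χ ⊆ cellSource n R∞) (i : FOIdx σ) :
    ContDiff ℝ ∞ (foCoef v σ i₀ j₀ θ χ i) := by
  rcases i with p | p
  · have h : ContDiff ℝ ∞ fun e : E∞ => placeCoord v p.2 (stabY v σ i₀ j₀ θ e p.1.1.1 p.1.1.2) :=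
      ((placeCoordCLM v p.2).comp (entryCLM p.1.1.1 p.1.1.2)).contDiff.comp (contDiff_stabY v σ i₀ j₀ θ)
    exact hχ.mul h
  · have h : ContDiffOn ℝ ∞ (fun e : E∞ => placeCoord v p.2 (stabX i₀ j₀ θ e p.1.1.1 p.1.1.2)) (cellSource n R∞) :=
      ((placeCoordCLM v p.2).comp (entryCLM p.1.1.1 p.1.1.2)).contDiff.comp_contDiffOn (contDiffOn_stabX i₀ j₀ θ)
    exact contDiff_smul_of_tsupport_subset (F := ℝ) hχ isOpen_cellSource h hsupp

end Family

/-! ### 3. The multiplier and the eigenvalue at `e₀ = (0, a, 0)` -/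

section AtPoint

variable (v : PlaceIdx K) (σ : Equiv.Perm (Fin n)) (i₀ j₀ : Fin n) (θ : mixedSpace K) (χ : CellParam n (mixedSpace K) → ℝ)

omit [NumberField K] in
/-- A matrix unit above the diagonal is strictly upper. [folklore] -/
theorem single_mem_strictUpper_of_lt {k l : Fin n} (hkl : k < l) (c : R∞) : (Matrix.single k l c : Mat) ∈ strictUpper n R∞ := by
  intro p q hpq
  rw [Matrix.single_apply, if_neg]
  rintro ⟨rfl, rfl⟩
  exact absurd hkl (not_lt.2 hpq)

/-- **The multiplier `Σ_i V_i(c_i)(e₀)` vanishes** (`χ = 1` near `e₀`): the `(k, l)` entries of `[π'V₁, Y₀]` and of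
`[stabX e₀, E_{kl} ε]` vanish. [cite: Shalika1974, §2] -/
theorem sum_fderiv_foCoef_foField_eq_zero (hbad : badPair σ i₀ j₀) {e₀ : E∞} (he₀ : e₀ ∈ cellSource n R∞) (h₁ : e₀.1 = 0)
    (h₂ : e₀.2.2 = 0) (hχ : χ =ᶠ[𝓝 e₀] 1) :
    ∑ i, fderiv ℝ (foCoef v σ i₀ j₀ θ χ i) e₀ (foField v σ χ i e₀) = 0 := by
  have hχ0 : χ e₀ = 1 := hχ.self_of_nhds
  refine Finset.sum_eq_zero fun i _ => ?_
  rcases i with ⟨kl, s⟩ | ⟨kl, s⟩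
  · have hev : foCoef v σ i₀ j₀ θ χ (Sum.inl (kl, s)) =ᶠ[𝓝 e₀] fun e => placeCoord v s (stabY v σ i₀ j₀ θ e kl.1.1 kl.1.2) := by
      filter_upwards [hχ] with e he
      simp only [foCoef, he, Pi.one_apply, one_mul]
    rw [hev.fderiv_eq, fderiv_placeCoord_entry v ((contDiff_stabY v σ i₀ j₀ θ).contDiffAt.differentiableAt (by simp)),
      fderiv_stabY_apply v σ i₀ j₀ θ h₁]
    simp only [foField, hχ0, one_smul]
    rw [comm_rootLow_apply_of_support i₀ j₀ θ (ne_of_lt hbad.1), placeCoord_zero]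
    intro p q hpq
    by_contra hne
    apply hpq
    apply piGood_apply_eq_zero
    rw [cellVecL_fst_apply_of_zero he₀ h₁ h₂]
    split_ifs
    · have hne' : ¬(kl.1.1 = p ∧ kl.1.2 = q) := fun h' => hne ⟨h'.1.symm, h'.2.symm⟩
      simp only [Matrix.single_apply, hne', if_false, neg_zero]
    · rfl
  · have hev : foCoef v σ i₀ j₀ θ χ (Sum.inr (kl, s)) =ᶠ[𝓝 e₀] fun e => placeCoord v s (stabX i₀ j₀ θ e kl.1.1 kl.1.2) := by
      filter_upwards [hχ] with e he
      simp only [foCoef, he, Pi.one_apply, one_mul]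
    have hX : (Matrix.single kl.1.1 kl.1.2 (placeUnit v s) : Mat) ∈ strictUpper n R∞ := single_mem_strictUpper_of_lt kl.2 _
    rw [hev.fderiv_eq, fderiv_placeCoord_entry v
      (((contDiffOn_stabX i₀ j₀ θ).contDiffAt (isOpen_cellSource.mem_nhds he₀)).differentiableAt (by simp))]
    simp only [foField, hχ0, one_smul]
    rw [fderiv_stabX_apply i₀ j₀ θ he₀ h₂ (cellVecR_snd_fst_of_zero he₀ h₁ h₂ hX), cellVecR_snd_snd_of_zero he₀ h₁ h₂ hX,
      comm_single_apply_self (stabX_mem_strictUpper i₀ j₀ θ hbad.1 he₀), placeCoord_zero]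

/-- **The eigenvalue `Σ_i c_i(e₀) μ_i`** at `e₀ = (0, a, 0)`:
`dψ(θ E_{f j₀, f i₀}) - dψ((a_{rev j₀}⁻¹ θ a_{rev i₀}) E_{rev j₀, rev i₀})`. [cite: Shalika1974, §2] -/
theorem sum_foCoef_mul_foEig (hbad : badPair σ i₀ j₀) (hθ : (placeIdem v : R∞) * θ = θ) {e₀ : E∞} (he₀ : e₀ ∈ cellSource n R∞)
    (h₁ : e₀.1 = 0) (h₂ : e₀.2.2 = 0) (hχ0 : χ e₀ = 1) :
    ∑ i, (foCoef v σ i₀ j₀ θ χ i e₀ : ℂ) * foEig v σ i =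
      archWhittakerDChar K (patFn σ j₀) (patFn σ i₀) θ -
        archWhittakerDChar K j₀.rev i₀.rev (↑((he₀ j₀.rev).unit⁻¹) * θ * e₀.2.1 i₀.rev) := by
  rw [Fintype.sum_sum_type, Fintype.sum_prod_type, Fintype.sum_prod_type]
  have hY0 : stabY v σ i₀ j₀ θ e₀ = rootLow i₀ j₀ θ := stabY_of_fst_eq_zero v σ i₀ j₀ θ h₁
  have hX0 := stabX_of_snd_snd_eq_zero i₀ j₀ θ he₀ h₂
  have hL : ∑ kl : LeftPatIdx σ, ∑ s : Fin 2, (foCoef v σ i₀ j₀ θ χ (Sum.inl (kl, s)) e₀ : ℂ) * foEig v σ (Sum.inl (kl, s)) =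
      archWhittakerDChar K (patFn σ j₀) (patFn σ i₀) θ := by
    rw [Finset.sum_eq_single (⟨(j₀, i₀), hbad.2⟩ : LeftPatIdx σ)]
    · simp only [foCoef, foEig, hχ0, one_mul, hY0, rootLow, Matrix.single_apply_same]
      exact sum_placeCoord_mul_archWhittakerDChar v hθ _ _
    · intro kl _ hkl
      refine Finset.sum_eq_zero fun s _ => ?_
      have h0 : rootLow i₀ j₀ θ kl.1.1 kl.1.2 = 0 := by
        rw [rootLow, Matrix.single_apply_of_ne]
        rintro ⟨h1, h2⟩
        exact hkl (Subtype.ext (Prod.ext h1.symm h2.symm))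
      simp only [foCoef, hχ0, one_mul, hY0, h0, placeCoord_zero, Complex.ofReal_zero, zero_mul]
    · intro h; exact absurd (Finset.mem_univ _) h
  have hθ' : (placeIdem v : R∞) * (↑((he₀ j₀.rev).unit⁻¹) * θ * e₀.2.1 i₀.rev) = ↑((he₀ j₀.rev).unit⁻¹) * θ * e₀.2.1 i₀.rev := by
    calc (placeIdem v : R∞) * (↑((he₀ j₀.rev).unit⁻¹) * θ * e₀.2.1 i₀.rev)
        = ↑((he₀ j₀.rev).unit⁻¹) * ((placeIdem v : R∞) * θ) * e₀.2.1 i₀.rev := by ring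
      _ = _ := by rw [hθ]
  have hR : ∑ kl : UpperIdx n, ∑ s : Fin 2, (foCoef v σ i₀ j₀ θ χ (Sum.inr (kl, s)) e₀ : ℂ) * foEig v σ (Sum.inr (kl, s)) =
      -archWhittakerDChar K j₀.rev i₀.rev (↑((he₀ j₀.rev).unit⁻¹) * θ * e₀.2.1 i₀.rev) := by
    rw [Finset.sum_eq_single (⟨(j₀.rev, i₀.rev), Fin.rev_lt_rev.2 hbad.1⟩ : UpperIdx n)]
    · simp only [foCoef, foEig, hχ0, one_mul, hX0, Matrix.single_apply_same, mul_neg, Finset.sum_neg_distrib]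
      rw [sum_placeCoord_mul_archWhittakerDChar v hθ']
    · intro kl _ hkl
      refine Finset.sum_eq_zero fun s _ => ?_
      have h0 : stabX i₀ j₀ θ e₀ kl.1.1 kl.1.2 = 0 := by
        rw [hX0, Matrix.single_apply_of_ne]
        rintro ⟨h1, h2⟩
        exact hkl (Subtype.ext (Prod.ext h1.symm h2.symm))
      simp only [foCoef, hχ0, one_mul, h0, placeCoord_zero, Complex.ofReal_zero, zero_mul]
    · intro h; exact absurd (Finset.mem_univ _) h
  rw [hL, hR, sub_eq_add_neg]

end AtPoint

/-! ### 4. The first-order equations in the chart -/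

section Equations

variable (v : PlaceIdx K) (σ : Equiv.Perm (Fin n))
variable {T : ↥(archTestFunctions n K) →ₗ[ℂ] ℂ}

/-- `L_Y g` in the chart is a test function for a test function `g` supported in `cellSource`. [folklore] -/
theorem isTestFn_cellOpL (Y : Mat) {g : E∞ → ℂ} (hg : IsTestFn g) (hgW : tsupport g ⊆ cellSource n R∞) : IsTestFn (cellOpL Y g) :=
  ⟨contDiff_cellOpL Y hg.contDiff hgW, hg.hasCompactSupport.mono' ((subset_tsupport _).trans (tsupport_cellOpL_subset Y g))⟩

/-- `R_X g` in the chart is a test function for a test function `g` supported in `cellSource`. [folklore] -/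
theorem isTestFn_cellOpR (X : Mat) {g : E∞ → ℂ} (hg : IsTestFn g) (hgW : tsupport g ⊆ cellSource n R∞) : IsTestFn (cellOpR X g) :=
  ⟨contDiff_cellOpR X hg.contDiff hgW, hg.hasCompactSupport.mono' ((subset_tsupport _).trans (tsupport_cellOpR_subset X g))⟩

/-- `Ψ_*(L_Y g) = L_Y (Ψ_* g)` as test functions. [folklore] -/
theorem cellPushFn_cellOpL {g : E∞ → ℂ} (hg : IsTestFn g) (hgW : tsupport g ⊆ cellSource n R∞) (Y : Mat)
    (hg' : IsTestFn (cellOpL Y g)) (hgW' : tsupport (cellOpL Y g) ⊆ cellSource n R∞) :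
    cellPushFn (cellOpL Y g) ⟨hg', hgW'⟩ = archTestFunctions.leftDeriv Y (cellPushFn g ⟨hg, hgW⟩) :=
  Subtype.ext (by
    rw [coe_cellPushFn, archTestFunctions.leftDeriv_apply, coe_cellPushFn,
      archLeftDeriv_cellPush hg.contDiff hg.hasCompactSupport hgW Y])

/-- `Ψ_*(R_X g) = R_X (Ψ_* g)` as test functions. [folklore] -/
theorem cellPushFn_cellOpR {g : E∞ → ℂ} (hg : IsTestFn g) (hgW : tsupport g ⊆ cellSource n R∞) (X : Mat)
    (hg' : IsTestFn (cellOpR X g)) (hgW' : tsupport (cellOpR X g) ⊆ cellSource n R∞) :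
    cellPushFn (cellOpR X g) ⟨hg', hgW'⟩ = archTestFunctions.rightDeriv X (cellPushFn g ⟨hg, hgW⟩) :=
  Subtype.ext (by
    rw [coe_cellPushFn, archTestFunctions.rightDeriv_apply, coe_cellPushFn,
      archRightDeriv_cellPush hg.contDiff hg.hasCompactSupport hgW X])

/-- **The left equation in the chart `ẇΨ`**: for `f k < f l` and `ε = placeUnit v s`,
`E (L_{E_{kl} ε} g) = dψ(E_{f k, f l} ε) E g` with `E = cellPull (T ∘ λ(ẇ))`. [cite: Shalika1974, §2] -/
theorem cellPull_cellOpL_eq (hT : IsArchDistribution n K T)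
    (hL : ∀ (u : ↥(upperUnitriangular (Fin n) (mixedSpace K))) (f : ↥(archTestFunctions n K)),
      T (archTestFunctions.leftTranslate (u : G∞) f) = archWhittakerChar n K u * T f)
    {τ : PlaceIdx K → Equiv.Perm (Fin n)} (hτ : τ v = Fin.revPerm * σ) (kl : LeftPatIdx σ) (s : Fin 2)
    {g : E∞ → ℂ} (hg : IsTestFn g) (hgW : tsupport g ⊆ cellSource n R∞) :
    cellPull (T.comp (archTestFunctions.leftTranslate (multiPermGL τ))) (cellOpL (Matrix.single kl.1.1 kl.1.2 (placeUnit v s)) g) =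
      archWhittakerDChar K (patFn σ kl.1.1) (patFn σ kl.1.2) (placeUnit v s) *
        cellPull (T.comp (archTestFunctions.leftTranslate (multiPermGL τ))) g := by
  have hg' := isTestFn_cellOpL (Matrix.single kl.1.1 kl.1.2 (placeUnit v s)) hg hgW
  have hgW' : tsupport (cellOpL (Matrix.single kl.1.1 kl.1.2 (placeUnit v s)) g) ⊆ cellSource n R∞ :=
    (tsupport_cellOpL_subset _ g).trans hgW
  rw [cellPull_eq _ hg' hgW', cellPull_eq _ hg hgW, cellPushFn_cellOpL hg hgW _ hg' hgW']
  have hY : adConjGL (multiPermGL τ) (Matrix.single kl.1.1 kl.1.2 (placeUnit v s)) =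
      Matrix.single (patFn σ kl.1.1) (patFn σ kl.1.2) (placeUnit v s) := by
    rw [adConjGL_multiPermGL_single τ v _ _ (placeIdem_mul_placeUnit v s), perm_symm_eq_patFn σ hτ, perm_symm_eq_patFn σ hτ]
  exact apply_leftDeriv_comp_leftTranslate hT hL (multiPermGL τ) kl.2 hY _

/-- **The right equation in the chart**: for `k < l`, `E (R_{E_{kl} ε} g) = -dψ(E_{kl} ε) E g`. [cite: Shalika1974, §2] -/
theorem cellPull_cellOpR_eq (hT : IsArchDistribution n K T)
    (hR : ∀ (u : ↥(upperUnitriangular (Fin n) (mixedSpace K))) (f : ↥(archTestFunctions n K)),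
      T (archTestFunctions.rightTranslate (u : G∞) f) = (archWhittakerChar n K u)⁻¹ * T f)
    (w : G∞) (kl : UpperIdx n) (s : Fin 2) {g : E∞ → ℂ} (hg : IsTestFn g) (hgW : tsupport g ⊆ cellSource n R∞) :
    cellPull (T.comp (archTestFunctions.leftTranslate w)) (cellOpR (Matrix.single kl.1.1 kl.1.2 (placeUnit v s)) g) =
      -archWhittakerDChar K kl.1.1 kl.1.2 (placeUnit v s) * cellPull (T.comp (archTestFunctions.leftTranslate w)) g := by
  have hg' := isTestFn_cellOpR (Matrix.single kl.1.1 kl.1.2 (placeUnit v s)) hg hgW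
  have hgW' : tsupport (cellOpR (Matrix.single kl.1.1 kl.1.2 (placeUnit v s)) g) ⊆ cellSource n R∞ :=
    (tsupport_cellOpR_subset _ g).trans hgW
  rw [cellPull_eq _ hg' hgW', cellPull_eq _ hg hgW, cellPushFn_cellOpR hg hgW _ hg' hgW']
  exact apply_rightDeriv_comp_leftTranslate hT hR w kl.2 (placeUnit v s) _

end Equations

/-! ### 5. The first-order vanishing at an irrelevant point of the cell -/

section Main

variable (v : PlaceIdx K) (σ : Equiv.Perm (Fin n)) (i₀ j₀ : Fin n) (θ : mixedSpace K)

set_option maxHeartbeats 1600000 in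
set_option synthInstance.maxHeartbeats 400000 in
/-- **First-order vanishing across an irrelevant point of a small cell** (Shalika, §2, via Hörmander,
Thm. 2.3.5).  Let `T` be a distribution on `GL_n(K_∞)`, left and right quasi-invariant under `U_n(K_∞)` for
`ψ_∞`, `E = cellPull (T ∘ λ(ẇ(τ)))` with `τ_v = rev ∘ σ`, `e₀ = (0, a, 0) ∈ cellSource`, `(i₀, j₀)` a bad pair of
`σ`, `θ = 1_v θ` with `dψ(θ E_{f j₀, f i₀}) ≠ dψ((a_{rev j₀}⁻¹ θ a_{rev i₀}) E_{rev j₀, rev i₀})`.  If `E`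
vanishes on the test functions supported near `e₀` off the cell `{π''_v X₁ = 0}`, then `E` vanishes on the
test functions supported near `e₀`. [cite: Shalika1974, §2, Thm. 2.1] -/
theorem cellPull_leftTranslate_vanish_near {T : ↥(archTestFunctions n K) →ₗ[ℂ] ℂ} (hT : IsArchDistribution n K T)
    (hL : ∀ (u : ↥(upperUnitriangular (Fin n) (mixedSpace K))) (f : ↥(archTestFunctions n K)),
      T (archTestFunctions.leftTranslate (u : G∞) f) = archWhittakerChar n K u * T f)
    (hR : ∀ (u : ↥(upperUnitriangular (Fin n) (mixedSpace K))) (f : ↥(archTestFunctions n K)),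
      T (archTestFunctions.rightTranslate (u : G∞) f) = (archWhittakerChar n K u)⁻¹ * T f)
    {τ : PlaceIdx K → Equiv.Perm (Fin n)} (hτ : τ v = Fin.revPerm * σ)
    {e₀ : E∞} (he₀ : e₀ ∈ cellSource n R∞) (h₁ : e₀.1 = 0) (h₂ : e₀.2.2 = 0)
    (hbad : badPair σ i₀ j₀) (hθ : (placeIdem v : R∞) * θ = θ)
    (hND : archWhittakerDChar K (patFn σ j₀) (patFn σ i₀) θ ≠
      archWhittakerDChar K j₀.rev i₀.rev (↑((he₀ j₀.rev).unit⁻¹) * θ * e₀.2.1 i₀.rev))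
    (hvanE : ∃ V₀ ∈ 𝓝 e₀, ∀ g : E∞ → ℂ, IsTestFn g → tsupport g ⊆ V₀ → (∀ x ∈ tsupport g, projB v σ x ≠ 0) →
      cellPull (T.comp (archTestFunctions.leftTranslate (multiPermGL τ))) g = 0) :
    ∃ V' ∈ 𝓝 e₀, ∀ g : E∞ → ℂ, IsTestFn g → tsupport g ⊆ V' →
      cellPull (T.comp (archTestFunctions.leftTranslate (multiPermGL τ))) g = 0 := by
  -- a smooth cutoff `χ = 1` on the ball `W = ball e₀ r ⊆ cellSource`, `tsupport χ ⊆ cellSource`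
  obtain ⟨χ, r, hr, hχs, hχsupp, hχ1, hWc⟩ := exists_smooth_cutoff isOpen_cellSource he₀
  have hχev : χ =ᶠ[𝓝 e₀] 1 := by
    filter_upwards [Metric.isOpen_ball.mem_nhds (Metric.mem_ball_self hr)] with x hx
    exact hχ1 x hx
  have hWo : IsOpen (Metric.ball e₀ r) := Metric.isOpen_ball
  have hx₀ : e₀ ∈ Metric.ball e₀ r := Metric.mem_ball_self hr
  -- the functional
  have hT' : IsArchDistribution n K (T.comp (archTestFunctions.leftTranslate (multiPermGL τ))) :=
    isArchDistribution_comp_leftTranslate T hT _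
  have hlin : IsLocallyLinearOn (Metric.ball e₀ r) (cellPull (T.comp (archTestFunctions.leftTranslate (multiPermGL τ)))) :=
    ⟨fun f g hf hg hfW hgW => cellPull_add _ f g hf hg (hfW.trans hWc) (hgW.trans hWc),
      fun c f hf hfW => cellPull_smul _ c f hf (hfW.trans hWc)⟩
  haveI : Module.Free ℝ E∞ := Module.Free.of_divisionRing ℝ E∞
  have hfin : IsFiniteOrderOn (Metric.ball e₀ r) (cellPull (T.comp (archTestFunctions.leftTranslate (multiPermGL τ)))) :=
    fun κ hκ hκW => isFiniteOrderOn_cellPull (Module.finBasis ℝ E∞) _ hT' κ hκ (hκW.trans hWc)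
  -- the splitting along the bad projection
  have hAfst : ∀ x : E∞, (projSplitEquiv (projB v σ) (projB_projB v σ) x).1 = 0 ↔ projB v σ x = 0 := fun x =>
    projSplitEquiv_fst_eq_zero_iff _ x
  have hx₀B : (projSplitEquiv (projB v σ) (projB_projB v σ) e₀).1 = 0 :=
    (hAfst e₀).2 ((projB_eq_zero_iff v σ e₀).2 (by rw [h₁, ZeroMemClass.coe_zero, piBad_zero]))
  refine vanish_near_of_firstOrder (projSplitEquiv (projB v σ) (projB_projB v σ)) hlin hfin hWo
    (Vf := foField v σ χ) (c := foCoef v σ i₀ j₀ θ χ) (μ := foEig v σ)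
    (contDiff_foField v σ χ hχs hχsupp) (contDiff_foCoef v σ i₀ j₀ θ χ hχs hχsupp) ?_ hx₀ hx₀B ?_ ?_ ?_ ?_
  · -- the equations
    intro i g hg hgW
    have hgWc : tsupport g ⊆ cellSource n R∞ := hgW.trans hWc
    rcases i with ⟨kl, s⟩ | ⟨kl, s⟩
    · have hfd : fieldDerivC (foField v σ χ (Sum.inl (kl, s))) g = cellOpL (Matrix.single kl.1.1 kl.1.2 (placeUnit v s)) g := by
        change fieldDerivC _ g = fieldDerivC (cellVecL (Matrix.single kl.1.1 kl.1.2 (placeUnit v s))) g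
        refine fieldDerivC_congr_of_eqOn fun x hx => ?_
        simp only [foField, hχ1 x (hgW hx), one_smul]
      rw [hfd]
      exact cellPull_cellOpL_eq v σ hT hL hτ kl s hg hgWc
    · have hfd : fieldDerivC (foField v σ χ (Sum.inr (kl, s))) g = cellOpR (Matrix.single kl.1.1 kl.1.2 (placeUnit v s)) g := by
        change fieldDerivC _ g = fieldDerivC (cellVecR (Matrix.single kl.1.1 kl.1.2 (placeUnit v s))) g
        refine fieldDerivC_congr_of_eqOn fun x hx => ?_
        simp only [foField, hχ1 x (hgW hx), one_smul]
      rw [hfd]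
      exact cellPull_cellOpR_eq v hT hR (multiPermGL τ) kl s hg hgWc
  · -- the total field vanishes on the cell
    intro x hx hAx
    exact sum_foCoef_smul_foField_eq_zero v σ i₀ j₀ θ χ hbad hθ (hWc hx) ((projB_eq_zero_iff v σ x).1 ((hAfst x).1 hAx))
  · -- nilpotency of the bad linearization
    have hfd : fderiv ℝ (fun x => ∑ i, foCoef v σ i₀ j₀ θ χ i x • foField v σ χ i x) e₀ = fderiv ℝ (fieldW v σ i₀ j₀ θ) e₀ := by
      refine Filter.EventuallyEq.fderiv_eq ?_
      filter_upwards [hχev, isOpen_cellSource.mem_nhds he₀] with x hx hxc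
      rw [sum_foCoef_smul_foField v σ i₀ j₀ θ χ hbad hθ hxc, hx, Pi.one_apply, one_mul, one_smul]
    have hN : IsNilpotent ((projB v σ).comp ((fderiv ℝ (fun x => ∑ i, foCoef v σ i₀ j₀ θ χ i x • foField v σ χ i x) e₀).comp (projB v σ))) := by
      rw [hfd]
      exact isNilpotent_projB_fderiv_fieldW_projB v σ i₀ j₀ θ he₀ h₁ h₂ hbad.1
    exact isNilpotent_normalPart_of_proj (projB_projB v σ) _ hN
  · -- multiplier ≠ eigenvalue
    rw [sum_fderiv_foCoef_foField_eq_zero v σ i₀ j₀ θ χ hbad he₀ h₁ h₂ hχev,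
      sum_foCoef_mul_foEig v σ i₀ j₀ θ χ hbad hθ he₀ h₁ h₂ hχev.self_of_nhds, Complex.ofReal_zero]
    intro h
    exact hND (sub_eq_zero.1 h.symm)
  · -- vanishing off the cell
    obtain ⟨V₀, hV₀, hV⟩ := hvanE
    exact ⟨V₀, hV₀, fun g hg hgV hgA => hV g hg hgV fun x hx hPx => hgA x hx ((hAfst x).2 hPx)⟩

end Main

end Literature.NumberTheory.Automorphic
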